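import Mathlib
import HarnessLib
import Summits.HubbardSuperconductivity.HubbardSuperconductivity.Theorems.KLProgrammeC4aChordMidpointDepth

/-!
# Route `KLProgramme` — crux C4a, S3 brick (B2-trans)(b) GEOMETRY, part 5: the assembled NON-DEGENERACY of the partner energy on the co-moving pp loop, DIRECT SHEET —
# small `|∂_φē|` and small partner level `|ē|` happen ONLY near the Cooper configuration (`‖ϑ − π‖_𝕋 ≲ ·`) or near the tangency corner (`‖ϑ‖_𝕋², ‖φ‖_𝕋² ≲ ·`)

Cell `gate-hubbard-kl`, seat hubbard-kl-k3c3-p3 g19 (row «implicit-function / monotonicity route for μ(n)»); helper for stub (C) `stub_twoLeg_curvature` of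
`KLRegimeEngineV17F2` (stmt-HubbardSuperconductivity-20437), lane hubbard-kl-c4a-1's S3 plan §24.10 (B2-trans)(b) «|ē| + |∂_φē| ≥ c(δ) on the loop circle» — here on
the DIRECT sheet (partner a chart point `Φ(e′,ψ)`), which is where the statement holds (this row's note HOME/hubbard-kl-k3c3-p3/B2TRANS-UMKLAPP.md: on klWindowC the
umklapp sheets `FS + 2πG` carry further crossings and the umklapp caustics; part 3′ `…C4aLoopAlignmentSheets` gives the sheet-`v` twin).
* **`loop_nondegeneracy_directSheet`** — parts 3 and 4 assembled: with `ℓ = De_K(Φ(e′,ψ))[∂_sΦ(e,φ+θ)] = −∂_φē` and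
  `τ = ((π/2)|ℓ|/((Dt−2A)u_min) + πKc|e′−e|/(Dt−2A)²)/(u_min·w/(4+2A))`: EITHER `(2u_min/π)‖ϑ − π‖_𝕋 ≤ msD·τ + |e−e′|/(Dt−2A)` (COOPER) OR
  `‖Φ(0,θ) − Φ(ρ,ϑ+θ)‖² ≤ 6π²(2A + |ρ| + Kc·(msD·τ + (|e|+|e′|)/(Dt−2A))/2)/(−μ−A−|ρ|)` (TANGENCY corner; `‖ϑ‖_𝕋 ≤ (π/(2u_min))‖chord‖` and
  `‖φ‖_𝕋 ≤ (π/(2u_min))(ε/2 + ‖chord‖/2)` by part 4's `torusDist_le_norm_chord` / `torusDist_loopAngle_le_of_midpoint_near`).  Read contrapositively, away from (C)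
  and the (T) corner `|ē| + |∂_φē|` is bounded below with `c(δ) ≍ min(δ_C, δ_T²)` up to the frame's `O(A)` and the leg level `|ρ|` — n-free, frame-uniform.
Everything proved on landed objects; nothing about the model's sizes; nothing asserts superconductivity.
References: BGM 2003 §7.1 Lemma 7.1 (A1.9) [cite: BenfattoGiulianiMastropietro2003]; FST II CPAM 51 (1998) §3, App. B [cite: FeldmanSalmhoferTrubowitz1998];
BGM 2006 §2.4 (2.40), App. A2 [cite: BenfattoGiulianiMastropietro2006].
-/

noncomputable section

namespace Summit.HubbardSuperconductivity.HubbardSuperconductivity.Theorems.C4a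

set_option linter.dupNamespace false -- summit = problem name (single-conjunct summit), D-0017

open Real Set
open Literature.MathematicalPhysics.QuantumLattice Literature.MathematicalPhysics.QuantumLattice.BandSectorCounting
open Literature.MathematicalPhysics.QuantumLattice.FermiRG
open Summit.HubbardSuperconductivity.HubbardSuperconductivity.Theorems.KLRegimeSplit
open Summit.HubbardSuperconductivity.HubbardSuperconductivity.Theorems.DispersionFlow
open Summit.HubbardSuperconductivity.HubbardSuperconductivity.Theorems.PerturbedFermiCurve

section Sizes

variable {K : TrigPolyC4v} {A : ℝ} (hA : ∀ p : Momentum, ∀ j ≤ 2, ‖iteratedFDeriv ℝ j (frameShift K) p‖ ≤ A) (hA20 : A ≤ 1 / 20)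
  (hd : klCurveD ≤ (bandBounds (show (-4 : ℝ) < -1.1 by norm_num) (show (-1.1 : ℝ) ≤ -0.1 by norm_num)
    (show (-0.1 : ℝ) < 0 by norm_num)).Dtmin - 2 * A)
  {μ r : ℝ} (hr : 0 < r) (hlo : (-1.1 : ℝ) < μ - r - A) (hhi : μ + r + A < -0.1)
  {A₃ A₄ : ℝ} (hA₃ : ∀ p : Momentum, ‖iteratedFDeriv ℝ 3 (frameShift K) p‖ ≤ A₃)
  (hA₄ : ∀ p : Momentum, ‖iteratedFDeriv ℝ 4 (frameShift K) p‖ ≤ A₄)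
include hA hA20 hd hr hlo hhi hA₃ hA₄

/-- **NON-DEGENERACY OF THE PARTNER ENERGY ON THE DIRECT SHEET** (parts 3 and 4 assembled).  Under clause (i) of `FrameOK`, for the co-moving pp loop point `Φ(e,φ+θ)`
(`|e| < r`, `|e| < r₀`) with external legs `Φ(0,θ)`, `Φ(ρ,ϑ+θ)` (`|ρ| < r`) whose partner `S − Φ(e,φ+θ)` is the DIRECT-SHEET chart point `Φ(e′,ψ)` (`|e′| < r`), write
`ℓ = De_K(Φ(e′,ψ))[∂_sΦ(e,φ+θ)]` (`= −∂_φē`, part 3) and `τ = ((π/2)|ℓ|/((Dt−2A)u_min) + πKc|e′ − e|/(Dt−2A)²)/(u_min·w/(4+2A))`.  Then EITHER (COOPER)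
`(2u_min/π)·‖ϑ − π‖_𝕋 ≤ msD·τ + |e − e′|/(Dt−2A)` OR (TANGENCY corner) `‖Φ(0,θ) − Φ(ρ,ϑ+θ)‖² ≤ 6π²(2A + |ρ| + Kc·(msD·τ + (|e|+|e′|)/(Dt−2A))/2)/(−μ−A−|ρ|)`,
whence `‖ϑ‖_𝕋 ≤ (π/(2u_min))·‖chord‖` (`torusDist_le_norm_chord`) and `‖φ‖_𝕋 ≤ (π/(2u_min))((msD·τ + …)/2 + ‖chord‖/2)` (`torusDist_loopAngle_le_of_midpoint_near`).
Read contrapositively: away from (C) and from the (T) corner, `|ē| + |∂_φē|` is bounded below — §24.10 (B2-trans)(b) on the direct sheet.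
[cite: BenfattoGiulianiMastropietro2003, §7.1 Lemma 7.1 (A1.9)] -/
theorem loop_nondegeneracy_directSheet {Kc r₀ g₀ w : ℝ} (hG : GeomConstants (frameLevel μ K) Kc r₀ g₀ w) {ρ e e' : ℝ} (hρ : |ρ| < r) (he : |e| < r)
    (he' : |e'| < r) (he₀ : |e| < r₀) {ϑ θ φ ψ : ℝ} (hP : pairSumPath μ K ρ ϑ θ 0 - levelPoint μ K e (φ + θ) = levelPoint μ K e' ψ) :
    2 * (bandBounds (show (-4 : ℝ) < -1.1 by norm_num) (show (-1.1 : ℝ) ≤ -0.1 by norm_num) (show (-0.1 : ℝ) < 0 by norm_num)).umin / π *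
          torusDist (ϑ - π) ≤
        msD A₃ A₄ 1 *
            ((π / 2 * |fderiv ℝ (frameLevel μ K) (levelPoint μ K e' ψ) (iteratedDeriv 1 (levelPoint μ K e) (φ + θ))| /
                  (((bandBounds (show (-4 : ℝ) < -1.1 by norm_num) (show (-1.1 : ℝ) ≤ -0.1 by norm_num) (show (-0.1 : ℝ) < 0 by norm_num)).Dtmin -
                      2 * A) *
                    (bandBounds (show (-4 : ℝ) < -1.1 by norm_num) (show (-1.1 : ℝ) ≤ -0.1 by norm_num) (show (-0.1 : ℝ) < 0 by norm_num)).umin) +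
                π * Kc * |e' - e| / ((bandBounds (show (-4 : ℝ) < -1.1 by norm_num) (show (-1.1 : ℝ) ≤ -0.1 by norm_num)
                  (show (-0.1 : ℝ) < 0 by norm_num)).Dtmin - 2 * A) ^ 2) /
              ((bandBounds (show (-4 : ℝ) < -1.1 by norm_num) (show (-1.1 : ℝ) ≤ -0.1 by norm_num) (show (-0.1 : ℝ) < 0 by norm_num)).umin * w /
                (4 + 2 * A))) +
          |e - e'| / ((bandBounds (show (-4 : ℝ) < -1.1 by norm_num) (show (-1.1 : ℝ) ≤ -0.1 by norm_num) (show (-0.1 : ℝ) < 0 by norm_num)).Dtmin - 2 * A) ∨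
      ‖levelPoint μ K 0 θ - levelPoint μ K ρ (ϑ + θ)‖ ^ 2 ≤
        6 * π ^ 2 * (2 * A + |ρ| + Kc *
          (msD A₃ A₄ 1 *
            ((π / 2 * |fderiv ℝ (frameLevel μ K) (levelPoint μ K e' ψ) (iteratedDeriv 1 (levelPoint μ K e) (φ + θ))| /
                  (((bandBounds (show (-4 : ℝ) < -1.1 by norm_num) (show (-1.1 : ℝ) ≤ -0.1 by norm_num) (show (-0.1 : ℝ) < 0 by norm_num)).Dtmin -
                      2 * A) *
                    (bandBounds (show (-4 : ℝ) < -1.1 by norm_num) (show (-1.1 : ℝ) ≤ -0.1 by norm_num) (show (-0.1 : ℝ) < 0 by norm_num)).umin) +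
                π * Kc * |e' - e| / ((bandBounds (show (-4 : ℝ) < -1.1 by norm_num) (show (-1.1 : ℝ) ≤ -0.1 by norm_num)
                  (show (-0.1 : ℝ) < 0 by norm_num)).Dtmin - 2 * A) ^ 2) /
              ((bandBounds (show (-4 : ℝ) < -1.1 by norm_num) (show (-1.1 : ℝ) ≤ -0.1 by norm_num) (show (-0.1 : ℝ) < 0 by norm_num)).umin * w /
                (4 + 2 * A))) +
            (|e| + |e'|) / ((bandBounds (show (-4 : ℝ) < -1.1 by norm_num) (show (-1.1 : ℝ) ≤ -0.1 by norm_num) (show (-0.1 : ℝ) < 0 by norm_num)).Dtmin -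
              2 * A)) / 2) / (-μ - A - |ρ|) := by
  rcases loopAlignment_dichotomy hA hA20 hd hr hlo hhi hA₃ hA₄ hG hρ he he' he₀ hP with h | h
  · exact Or.inl h
  · exact Or.inr (norm_chord_sq_le_of_midpoint_near hA hr hlo hhi hG hρ h)

end Sizes

end Summit.HubbardSuperconductivity.HubbardSuperconductivity.Theorems.C4a

end
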